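import Mathlib.Analysis.SpecialFunctions.Trigonometric.ArctanDeriv
import Mathlib.Analysis.ODE.ExistUnique
import Summits.AtomisticToContinuum.BoseEinsteinCondensation.Theorems.BECThomsonPrincipleDensityResponseDefs

/-!
# Route `BECThomsonPrinciple`, crux `DensityResponse` (stmt-AtomisticToContinuum-9481),
# line `force-balance-constitutive` — sub-goal `stub_angleFlow` of stub S1 (`TransportStationary`)

The transport step of S1 flows every boson along the displacement field `u_k(x) = k sin(k·x)/|k|²`;
per particle the phase `θ = k·x` then moves by the one-dimensional ODE `θ' = sin θ`. This file gives
that ANGLE FLOW in closed form, `θ ↦ θ + δ(τ, θ)` with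

  `δ(τ, θ) = 2 · arctan ( sin θ · (e^τ - 1) / ((1 + cos θ) + e^τ (1 - cos θ)) )`

(the half-angle substitution `tan(θ/2) ↦ e^τ tan(θ/2)` written without poles: the denominator
`R = (1 + cos θ) + e^τ (1 - cos θ)` is `> 0`; multiplying numerator and denominator by `R / (2e^τ)`
gives the equivalent symmetric form
`2 · arctan ( sin θ (cos θ - cos θ cosh τ + sinh τ) / ((1 + cos² θ) cosh τ - 2 cos θ sinh τ + sin² θ) )`),
together with everything the `N`-body construction consumes, packaged as the registered sub-goal
`stub_angleFlow` of the skeleton `Cruxes/DensityResponse/Lines/force-balance-constitutive.lean`: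

* joint smoothness `ContDiff ℝ n (fun p => δ p.1 p.2)` (all `n`; the stub asks for `n = 2`);
* `δ(0, θ) = 0` and `2π`-periodicity in `θ` (only `cos θ`, `sin θ` enter);
* the Möbius boost formulas `cos(θ + δ) · D = cos θ cosh τ - sinh τ`, `sin(θ + δ) · D = sin θ` with the
  Jacobian factor `D(τ, θ) = cosh τ - cos θ sinh τ > 0`;
* the `θ`-derivative `∂_θ (θ + δ) = 1 / D` and the flow equation `∂_τ δ = sin(θ + δ)`;
* the flow law `δ(τ + σ, θ) = δ(σ, θ) + δ(τ, θ + δ(σ, θ))`, obtained from the flow equation by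
  uniqueness of solutions of the Lipschitz ODE `y' = sin(θ + y)` (`ODE_solution_unique_univ`).

All identities reduce, via `cos (2 arctan T) = (1 - T²)/(1 + T²)`, `sin (2 arctan T) = 2T/(1 + T²)`
and `(1 + T²) R² = 2M`, `M = (1 + cos θ) + e^{2τ}(1 - cos θ) = 2 e^τ D`, to polynomial identities in
`cos θ, sin θ, e^τ` modulo `sin² + cos² = 1`, discharged by `linear_combination`.
Elementary calculus; no named facts are used.
-/

namespace Summit.AtomisticToContinuum.BoseEinsteinCondensation.Cruxes.DensityResponse.ForceBalanceConstitutive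

noncomputable section

open Real

/-! ### Polynomial identities on the unit circle -/

section Algebra

/-- `(1 + c) + E (1 - c) > 0` for `-1 ≤ c ≤ 1` and `E > 0`. [folklore] -/
private theorem den_pos {c E : ℝ} (h1 : -1 ≤ c) (h2 : c ≤ 1) (hE : 0 < E) :
    0 < 1 + c + E * (1 - c) := by
  rcases h2.lt_or_eq with h | h
  · have : 0 < E * (1 - c) := mul_pos hE (by linarith)
    linarith
  · rw [h]; norm_num

/-- `R² + s²(E - 1)² = 2M` on the circle (`R = 1 + c + E(1 - c)`, `M = 1 + c + E²(1 - c)`).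
[folklore] -/
private theorem alg_normSq (c s E : ℝ) (h : s ^ 2 + c ^ 2 = 1) :
    (1 + c + E * (1 - c)) ^ 2 + (s * (E - 1)) ^ 2 = 2 * (1 + c + E ^ 2 * (1 - c)) := by
  linear_combination (E - 1) ^ 2 * h

/-- The cosine boost identity in polynomial form. [folklore] -/
private theorem alg_cos (c s E : ℝ) (h : s ^ 2 + c ^ 2 = 1) :
    c * ((1 + c + E * (1 - c)) ^ 2 - (1 + c + E ^ 2 * (1 - c)))
      - s * (s * (E - 1) * (1 + c + E * (1 - c))) = 1 + c - (1 - c) * E ^ 2 := by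
  linear_combination (-(E - 1) * (1 + c + E * (1 - c))) * h

/-- The sine boost identity in polynomial form. [folklore] -/
private theorem alg_sin (c s E : ℝ) :
    s * ((1 + c + E * (1 - c)) ^ 2 - (1 + c + E ^ 2 * (1 - c)))
      + c * (s * (E - 1) * (1 + c + E * (1 - c))) = 2 * E * s := by
  ring

/-- The Jacobian identity in polynomial form. [folklore] -/
private theorem alg_jac (c s E : ℝ) (h : s ^ 2 + c ^ 2 = 1) :
    1 + c + E ^ 2 * (1 - c) + (c * (E - 1) * (1 + c + E * (1 - c)) - s * (E - 1) * ((E - 1) * s)) =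
      2 * E := by
  linear_combination (-(E - 1) ^ 2) * h

/-- `2 e^τ (cosh τ - c sinh τ) = (1 + c) + e^{2τ} (1 - c)`. [folklore] -/
private theorem two_mul_exp_mul_jac (τ c : ℝ) :
    2 * exp τ * (cosh τ - c * sinh τ) = 1 + c + exp τ ^ 2 * (1 - c) := by
  rw [cosh_eq, sinh_eq, exp_neg]
  have h := exp_pos τ
  field_simp
  ring

/-- `2 e^τ (c cosh τ - sinh τ) = (1 + c) - (1 - c) e^{2τ}`. [folklore] -/
private theorem two_mul_exp_mul_boost (τ c : ℝ) :
    2 * exp τ * (c * cosh τ - sinh τ) = 1 + c - (1 - c) * exp τ ^ 2 := by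
  rw [cosh_eq, sinh_eq, exp_neg]
  have h := exp_pos τ
  field_simp
  ring

/-- Double angle: `cos (2 arctan x) · (1 + x²) = 1 - x²`. [folklore] -/
private theorem cos_two_mul_arctan_mul (x : ℝ) : cos (2 * arctan x) * (1 + x ^ 2) = 1 - x ^ 2 := by
  have h : (0 : ℝ) < 1 + x ^ 2 := by positivity
  rw [cos_two_mul, cos_sq_arctan]
  field_simp
  ring

/-- Double angle: `sin (2 arctan x) · (1 + x²) = 2x`. [folklore] -/
private theorem sin_two_mul_arctan_mul (x : ℝ) : sin (2 * arctan x) * (1 + x ^ 2) = 2 * x := by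
  have h : (0 : ℝ) < 1 + x ^ 2 := by positivity
  rw [sin_two_mul, ← tan_mul_cos (cos_arctan_pos x).ne', tan_arctan]
  have : 2 * (x * cos (arctan x)) * cos (arctan x) * (1 + x ^ 2) =
      2 * x * (cos (arctan x) ^ 2 * (1 + x ^ 2)) := by ring
  rw [this, cos_sq_arctan]
  field_simp

end Algebra

/-! ### The closed form of the angle flow -/

/-- The denominator `R(τ, θ) = (1 + cos θ) + e^τ (1 - cos θ)` of `tan(δ/2)` (positive). -/
def angleFlowDen (τ θ : ℝ) : ℝ := 1 + cos θ + exp τ * (1 - cos θ)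

/-- `T(τ, θ) = tan(δ(τ, θ)/2) = sin θ (e^τ - 1) / R(τ, θ)`. -/
def angleFlowTan (τ θ : ℝ) : ℝ := sin θ * (exp τ - 1) / angleFlowDen τ θ

/-- The ANGLE FLOW of `θ' = sin θ`: the solution through `θ` at time `τ` is `θ + angleFlow τ θ`, with
`angleFlow τ θ = δ(τ, θ) = 2 arctan (sin θ (e^τ - 1) / ((1 + cos θ) + e^τ (1 - cos θ))) ∈ (-π, π)`
(half-angle form: `tan((θ + δ)/2) = e^τ tan(θ/2)`). -/
def angleFlow (τ θ : ℝ) : ℝ := 2 * arctan (angleFlowTan τ θ)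

/-- `R(τ, θ) > 0`. [folklore] -/
theorem angleFlowDen_pos (τ θ : ℝ) : 0 < angleFlowDen τ θ :=
  den_pos (neg_one_le_cos θ) (cos_le_one θ) (exp_pos τ)

/-- `M(τ, θ) = (1 + cos θ) + e^{2τ} (1 - cos θ) > 0`. [folklore] -/
private theorem normDen_pos (τ θ : ℝ) : 0 < 1 + cos θ + exp τ ^ 2 * (1 - cos θ) :=
  den_pos (neg_one_le_cos θ) (cos_le_one θ) (pow_pos (exp_pos τ) 2)

/-- The Jacobian factor is positive: `0 < D(τ, θ) = cosh τ - cos θ sinh τ`. [folklore] -/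
theorem jacFactor_pos (τ θ : ℝ) : 0 < cosh τ - cos θ * sinh τ := by
  have hM := normDen_pos τ θ
  rw [← two_mul_exp_mul_jac] at hM
  exact pos_of_mul_pos_right hM (by positivity)

/-- `(1 + T²) R² = 2M`. [folklore] -/
theorem one_add_angleFlowTan_sq_mul (τ θ : ℝ) :
    (1 + angleFlowTan τ θ ^ 2) * angleFlowDen τ θ ^ 2 = 2 * (1 + cos θ + exp τ ^ 2 * (1 - cos θ)) := by
  have hR : (1 + cos θ + exp τ * (1 - cos θ)) ^ 2 ≠ 0 := pow_ne_zero 2 (angleFlowDen_pos τ θ).ne'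
  unfold angleFlowTan angleFlowDen
  rw [div_pow, add_mul, one_mul, div_mul_cancel₀ _ hR]
  exact alg_normSq (cos θ) (sin θ) (exp τ) (sin_sq_add_cos_sq θ)

/-- `1 + T² = 2M / R²`. [folklore] -/
theorem one_add_angleFlowTan_sq (τ θ : ℝ) :
    1 + angleFlowTan τ θ ^ 2 = 2 * (1 + cos θ + exp τ ^ 2 * (1 - cos θ)) / angleFlowDen τ θ ^ 2 := by
  rw [eq_div_iff (pow_ne_zero 2 (angleFlowDen_pos τ θ).ne')]
  exact one_add_angleFlowTan_sq_mul τ θ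

/-- `cos δ · M = R² - M`. [folklore] -/
theorem cos_angleFlow_mul (τ θ : ℝ) :
    cos (angleFlow τ θ) * (1 + cos θ + exp τ ^ 2 * (1 - cos θ)) =
      angleFlowDen τ θ ^ 2 - (1 + cos θ + exp τ ^ 2 * (1 - cos θ)) := by
  have h1 := cos_two_mul_arctan_mul (angleFlowTan τ θ)
  have h2 := one_add_angleFlowTan_sq_mul τ θ
  unfold angleFlow
  linear_combination (angleFlowDen τ θ ^ 2 / 2) * h1 - ((cos (2 * arctan (angleFlowTan τ θ)) + 1) / 2) * h2

/-- `sin δ · M = sin θ (e^τ - 1) R`. [folklore] -/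
theorem sin_angleFlow_mul (τ θ : ℝ) :
    sin (angleFlow τ θ) * (1 + cos θ + exp τ ^ 2 * (1 - cos θ)) =
      sin θ * (exp τ - 1) * angleFlowDen τ θ := by
  have h1 := sin_two_mul_arctan_mul (angleFlowTan τ θ)
  have h2 := one_add_angleFlowTan_sq_mul τ θ
  have h3 : angleFlowTan τ θ * angleFlowDen τ θ = sin θ * (exp τ - 1) :=
    div_mul_cancel₀ _ (angleFlowDen_pos τ θ).ne'
  unfold angleFlow
  linear_combination (angleFlowDen τ θ ^ 2 / 2) * h1 - (sin (2 * arctan (angleFlowTan τ θ)) / 2) * h2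
    + angleFlowDen τ θ * h3

/-! ### The eight properties -/

/-- Joint smoothness: `(τ, θ) ↦ δ(τ, θ)` is `C^n` for every `n` (composition of `arctan`, `exp`, `cos`,
`sin` and a quotient with non-vanishing denominator). [folklore] -/
theorem contDiff_angleFlow {n : WithTop ℕ∞} : ContDiff ℝ n (fun p : ℝ × ℝ => angleFlow p.1 p.2) := by
  have h : ∀ p : ℝ × ℝ, 1 + cos p.2 + exp p.1 * (1 - cos p.2) ≠ 0 := fun p =>
    (angleFlowDen_pos p.1 p.2).ne'
  unfold angleFlow angleFlowTan angleFlowDen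
  refine contDiff_const.mul (contDiff_arctan.comp ?_)
  exact ContDiff.div (by fun_prop) (by fun_prop) h

/-- `δ(0, θ) = 0`. [folklore] -/
theorem angleFlow_zero (θ : ℝ) : angleFlow 0 θ = 0 := by
  simp [angleFlow, angleFlowTan]

/-- `2π`-periodicity in the angle. [folklore] -/
theorem angleFlow_add_two_pi (τ θ : ℝ) : angleFlow τ (θ + 2 * π) = angleFlow τ θ := by
  simp only [angleFlow, angleFlowTan, angleFlowDen, cos_add_two_pi, sin_add_two_pi]

/-- The cosine boost formula `cos(θ + δ) · (cosh τ - cos θ sinh τ) = cos θ cosh τ - sinh τ`. [folklore] -/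
theorem cos_add_angleFlow_mul (τ θ : ℝ) :
    cos (θ + angleFlow τ θ) * (cosh τ - cos θ * sinh τ) = cos θ * cosh τ - sinh τ := by
  have hE : (2 * exp τ) ≠ 0 := by positivity
  apply mul_left_cancel₀ hE
  have hc := cos_angleFlow_mul τ θ
  have hs := sin_angleFlow_mul τ θ
  have hJ := two_mul_exp_mul_jac τ (cos θ)
  have hK := two_mul_exp_mul_boost τ (cos θ)
  have hA := alg_cos (cos θ) (sin θ) (exp τ) (sin_sq_add_cos_sq θ)
  simp only [angleFlowDen] at hc hs
  rw [cos_add]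
  linear_combination (cos θ * cos (angleFlow τ θ) - sin θ * sin (angleFlow τ θ)) * hJ - hK
    + cos θ * hc - sin θ * hs + hA

/-- The sine boost formula `sin(θ + δ) · (cosh τ - cos θ sinh τ) = sin θ`. [folklore] -/
theorem sin_add_angleFlow_mul (τ θ : ℝ) :
    sin (θ + angleFlow τ θ) * (cosh τ - cos θ * sinh τ) = sin θ := by
  have hE : (2 * exp τ) ≠ 0 := by positivity
  apply mul_left_cancel₀ hE
  have hc := cos_angleFlow_mul τ θ
  have hs := sin_angleFlow_mul τ θ
  have hJ := two_mul_exp_mul_jac τ (cos θ)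
  have hB := alg_sin (cos θ) (sin θ) (exp τ)
  simp only [angleFlowDen] at hc hs
  rw [sin_add]
  linear_combination (sin θ * cos (angleFlow τ θ) + cos θ * sin (angleFlow τ θ)) * hJ
    + sin θ * hc + cos θ * hs + hB

/-- `sin(θ + δ) = 2 e^τ sin θ / M`. [folklore] -/
private theorem sin_add_angleFlow_eq (τ θ : ℝ) :
    sin (θ + angleFlow τ θ) = 2 * exp τ * sin θ / (1 + cos θ + exp τ ^ 2 * (1 - cos θ)) := by
  rw [eq_div_iff (normDen_pos τ θ).ne']
  have h := sin_add_angleFlow_mul τ θ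
  have hJ := two_mul_exp_mul_jac τ (cos θ)
  linear_combination (2 * exp τ) * h - sin (θ + angleFlow τ θ) * hJ

/-- The flow equation `∂_τ δ(τ, θ) = sin(θ + δ(τ, θ))`. [folklore] -/
theorem hasDerivAt_angleFlow (τ θ : ℝ) :
    HasDerivAt (fun t => angleFlow t θ) (sin (θ + angleFlow τ θ)) τ := by
  have hR := angleFlowDen_pos τ θ
  have hM := normDen_pos τ θ
  have hD : HasDerivAt (fun t => angleFlowDen t θ) (exp τ * (1 - cos θ)) τ :=
    ((hasDerivAt_exp τ).mul_const (1 - cos θ)).const_add (1 + cos θ)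
  have hP : HasDerivAt (fun t => sin θ * (exp t - 1)) (sin θ * exp τ) τ := by
    simpa using ((hasDerivAt_exp τ).sub_const 1).const_mul (sin θ)
  have hT : HasDerivAt (fun t => angleFlowTan t θ)
      ((sin θ * exp τ * angleFlowDen τ θ - sin θ * (exp τ - 1) * (exp τ * (1 - cos θ))) /
        angleFlowDen τ θ ^ 2) τ := hP.div hD hR.ne'
  have hδ : HasDerivAt (fun t => angleFlow t θ)
      (2 * (1 / (1 + angleFlowTan τ θ ^ 2) *
        ((sin θ * exp τ * angleFlowDen τ θ - sin θ * (exp τ - 1) * (exp τ * (1 - cos θ))) /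
          angleFlowDen τ θ ^ 2))) τ := hT.arctan.const_mul 2
  refine hδ.congr_deriv ?_
  rw [sin_add_angleFlow_eq, one_add_angleFlowTan_sq]
  have hR' := hR.ne'
  have hM' := hM.ne'
  field_simp
  unfold angleFlowDen
  ring

/-- The `θ`-Jacobian of the flow map: `∂_θ (θ + δ(τ, θ)) = (cosh τ - cos θ sinh τ)⁻¹`. [folklore] -/
theorem hasDerivAt_id_add_angleFlow (τ θ : ℝ) :
    HasDerivAt (fun x : ℝ => x + angleFlow τ x) (cosh τ - cos θ * sinh τ)⁻¹ θ := by
  have hR := angleFlowDen_pos τ θ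
  have hM := normDen_pos τ θ
  have hD : HasDerivAt (fun x => angleFlowDen τ x) ((exp τ - 1) * sin θ) θ := by
    have h := ((hasDerivAt_cos θ).const_add 1).add (((hasDerivAt_cos θ).const_sub 1).const_mul (exp τ))
    exact h.congr_deriv (by ring)
  have hP : HasDerivAt (fun x => sin x * (exp τ - 1)) (cos θ * (exp τ - 1)) θ :=
    (hasDerivAt_sin θ).mul_const _
  have hT : HasDerivAt (fun x => angleFlowTan τ x)
      ((cos θ * (exp τ - 1) * angleFlowDen τ θ - sin θ * (exp τ - 1) * ((exp τ - 1) * sin θ)) /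
        angleFlowDen τ θ ^ 2) θ := hP.div hD hR.ne'
  have hδ : HasDerivAt (fun x : ℝ => x + angleFlow τ x)
      (1 + 2 * (1 / (1 + angleFlowTan τ θ ^ 2) *
        ((cos θ * (exp τ - 1) * angleFlowDen τ θ - sin θ * (exp τ - 1) * ((exp τ - 1) * sin θ)) /
          angleFlowDen τ θ ^ 2))) θ := (hasDerivAt_id' θ).add (hT.arctan.const_mul 2)
  refine hδ.congr_deriv ?_
  have hJ := two_mul_exp_mul_jac τ (cos θ)
  have hD0 := (jacFactor_pos τ θ).ne'
  have hE := (exp_pos τ).ne'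
  have hDinv : (cosh τ - cos θ * sinh τ)⁻¹ = 2 * exp τ / (1 + cos θ + exp τ ^ 2 * (1 - cos θ)) := by
    rw [← hJ]
    field_simp
  have hX : 2 * (1 / (1 + angleFlowTan τ θ ^ 2) *
      ((cos θ * (exp τ - 1) * angleFlowDen τ θ - sin θ * (exp τ - 1) * ((exp τ - 1) * sin θ)) /
        angleFlowDen τ θ ^ 2)) =
      (cos θ * (exp τ - 1) * angleFlowDen τ θ - sin θ * (exp τ - 1) * ((exp τ - 1) * sin θ)) /
        (1 + cos θ + exp τ ^ 2 * (1 - cos θ)) := by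
    rw [one_add_angleFlowTan_sq]
    have hR' := hR.ne'
    have hM' := hM.ne'
    field_simp
  have key : 1 + cos θ + exp τ ^ 2 * (1 - cos θ) +
      (cos θ * (exp τ - 1) * angleFlowDen τ θ - sin θ * (exp τ - 1) * ((exp τ - 1) * sin θ)) =
      2 * exp τ := by
    unfold angleFlowDen
    exact alg_jac (cos θ) (sin θ) (exp τ) (sin_sq_add_cos_sq θ)
  rw [hX, hDinv, one_add_div hM.ne', key]

/-- The FLOW LAW `δ(τ + σ, θ) = δ(σ, θ) + δ(τ, θ + δ(σ, θ))`: both sides solve the Lipschitz ODE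
`y' = sin(θ + y)` in `τ` with the same value at `τ = 0`. [folklore] -/
theorem angleFlow_add (τ σ θ : ℝ) :
    angleFlow (τ + σ) θ = angleFlow σ θ + angleFlow τ (θ + angleFlow σ θ) := by
  have hv : ∀ t : ℝ, LipschitzOnWith 1 ((fun (_ : ℝ) (y : ℝ) => sin (θ + y)) t) Set.univ := by
    intro t
    refine (LipschitzWith.mk_one fun x y => ?_).lipschitzOnWith
    rw [Real.dist_eq, Real.dist_eq]
    have h := abs_sin_sub_sin_le (θ + x) (θ + y)
    rwa [add_sub_add_left_eq_sub] at h
  have hf : ∀ t : ℝ, HasDerivAt (fun t => angleFlow (t + σ) θ)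
      ((fun (_ : ℝ) (y : ℝ) => sin (θ + y)) t (angleFlow (t + σ) θ)) t ∧
        angleFlow (t + σ) θ ∈ (fun _ : ℝ => (Set.univ : Set ℝ)) t := fun t =>
    ⟨HasDerivAt.comp_add_const t σ (hasDerivAt_angleFlow (t + σ) θ), Set.mem_univ _⟩
  have hg : ∀ t : ℝ, HasDerivAt (fun t => angleFlow σ θ + angleFlow t (θ + angleFlow σ θ))
      ((fun (_ : ℝ) (y : ℝ) => sin (θ + y)) t (angleFlow σ θ + angleFlow t (θ + angleFlow σ θ))) t ∧
        angleFlow σ θ + angleFlow t (θ + angleFlow σ θ) ∈ (fun _ : ℝ => (Set.univ : Set ℝ)) t :=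
    fun t => ⟨((hasDerivAt_angleFlow t (θ + angleFlow σ θ)).const_add (angleFlow σ θ)).congr_deriv
      (by rw [add_assoc]), Set.mem_univ _⟩
  have heq : (fun t => angleFlow (t + σ) θ) 0 =
      (fun t => angleFlow σ θ + angleFlow t (θ + angleFlow σ θ)) 0 := by
    simp [angleFlow_zero]
  have h := ODE_solution_unique_univ hv hf hg heq
  exact congrFun h τ

/-! ### Consequences used by the configuration-space transport -/

/-- Periodicity under integer multiples of `2π`. [folklore] -/
theorem angleFlow_add_int_mul_two_pi (τ θ : ℝ) (m : ℤ) :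
    angleFlow τ (θ + m * (2 * π)) = angleFlow τ θ := by
  simp only [angleFlow, angleFlowTan, angleFlowDen, cos_add_int_mul_two_pi, sin_add_int_mul_two_pi]

/-- The inverse law `δ(-τ, θ + δ(τ, θ)) = -δ(τ, θ)` (flow law at `σ = τ`, `τ = -τ`). [folklore] -/
theorem angleFlow_neg_add (τ θ : ℝ) : angleFlow (-τ) (θ + angleFlow τ θ) = -angleFlow τ θ := by
  have h := angleFlow_add (-τ) τ θ
  rw [neg_add_cancel, angleFlow_zero] at h
  linarith

/-- The `θ`-derivative of `δ` itself: `∂_θ δ(τ, θ) = (cosh τ - cos θ sinh τ)⁻¹ - 1`. [folklore] -/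
theorem hasDerivAt_angleFlow_theta (τ θ : ℝ) :
    HasDerivAt (fun x : ℝ => angleFlow τ x) ((cosh τ - cos θ * sinh τ)⁻¹ - 1) θ :=
  ((hasDerivAt_id_add_angleFlow τ θ).sub (hasDerivAt_id' θ)).congr_of_eventuallyEq
    (Filter.Eventually.of_forall fun x => (add_sub_cancel_left x (angleFlow τ x)).symm)

/-- `|δ| < π`. [folklore] -/
theorem abs_angleFlow_lt_pi (τ θ : ℝ) : |angleFlow τ θ| < π := by
  have h1 := arctan_lt_pi_div_two (angleFlowTan τ θ)
  have h2 := neg_pi_div_two_lt_arctan (angleFlowTan τ θ)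
  rw [angleFlow, abs_lt]
  constructor <;> linarith

/-- **Registered sub-goal `stub_angleFlow` of S1** (line `force-balance-constitutive`, crux
stmt-AtomisticToContinuum-9481): the closed-form angle flow of `θ' = sin θ` with joint smoothness,
`δ(0, ·) = 0`, `2π`-periodicity, the flow law, the cosine/sine boost formulas, the `θ`-Jacobian
`1/(cosh τ - cos θ sinh τ)` and the flow equation `∂_τ δ = sin(θ + δ)`; witness `angleFlow`. [folklore] -/
theorem stub_angleFlow : ∃ δ : ℝ → ℝ → ℝ, ContDiff ℝ 2 (fun p : ℝ × ℝ => δ p.1 p.2) ∧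
    (∀ θ : ℝ, δ 0 θ = 0) ∧ (∀ τ θ : ℝ, δ τ (θ + 2 * Real.pi) = δ τ θ) ∧
    (∀ τ σ θ : ℝ, δ (τ + σ) θ = δ σ θ + δ τ (θ + δ σ θ)) ∧
    (∀ τ θ : ℝ, Real.cos (θ + δ τ θ) * (Real.cosh τ - Real.cos θ * Real.sinh τ) =
      Real.cos θ * Real.cosh τ - Real.sinh τ) ∧
    (∀ τ θ : ℝ, Real.sin (θ + δ τ θ) * (Real.cosh τ - Real.cos θ * Real.sinh τ) = Real.sin θ) ∧
    (∀ τ θ : ℝ, HasDerivAt (fun x : ℝ => x + δ τ x) (Real.cosh τ - Real.cos θ * Real.sinh τ)⁻¹ θ) ∧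
    (∀ τ θ : ℝ, HasDerivAt (fun t : ℝ => δ t θ) (Real.sin (θ + δ τ θ)) τ) :=
  ⟨angleFlow, contDiff_angleFlow, angleFlow_zero, angleFlow_add_two_pi, angleFlow_add,
    cos_add_angleFlow_mul, sin_add_angleFlow_mul, hasDerivAt_id_add_angleFlow, hasDerivAt_angleFlow⟩

end

end Summit.AtomisticToContinuum.BoseEinsteinCondensation.Cruxes.DensityResponse.ForceBalanceConstitutive
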